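import Mathlib
import HarnessLib
import Summits.ResolutionOfSingularities.ResolutionOfSingularities.Theorems.WildQuotientsWildQuotientResolutionToricExitJordanThreeBricks
import Summits.ResolutionOfSingularities.ResolutionOfSingularities.Theorems.WildQuotientsWildQuotientResolutionToricExitJordanThreeBrickDiv
import Summits.ResolutionOfSingularities.ResolutionOfSingularities.Theorems.WildQuotientsWildQuotientResolutionToricExitJordanThreeBrickNonempty
import Summits.ResolutionOfSingularities.ResolutionOfSingularities.Theorems.WildQuotientsWildQuotientResolutionToricExitJordanThreeBrickRegular
import Summits.ResolutionOfSingularities.ResolutionOfSingularities.Theorems.WildQuotientsWildQuotientResolutionJordanThreeOrderP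
import Summits.ResolutionOfSingularities.ResolutionOfSingularities.Theorems.WildQuotientsWildQuotientResolutionToricExitJordanThreeConeBrick

/-!
# V3U-F: every `𝔸ⁿ/J₃` has a resolution of singularities (all `p ≥ 3`)
(crux stmt-ResolutionOfSingularities-15640 `WildQuotients.WildQuotientResolution`, line `Sketch`;
chain w45c programme V3U FINAL `jordanThree_hasResolution` — REGISTERED stub of the crux item;
`L/w45c/CHAIN.md` v7.x §4 lead-1 row; [OURS · L1 W4.5c] — NOT a statement of any manuscript; replaces
the role of no printed item.)

`ToricExit.jordanThree_hasResolution`: for every field `k` of characteristic `p ≥ 3`, every `n` and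
the `J₃` datum `σ` on `k[x₁,…,xₙ]` (`σ x_a = x_a`, `σ x_b = x_b + x_a`, `σ x_c = x_c + x_b`, the other
variables fixed — a Jordan block of size 3 plus passengers), the wild quotient `Spec k[x]^⟨σ⟩` has a
resolution of singularities. Proof = the toric exit: `V = Bl_{(x_a, x_b²)} 𝔸ⁿ` with the lifted
action, the terminal piece `⋂ g·V[x_b²]` (Király–Lütkebohmert transfer) and the cone piece
`V[x_a]/G ≅ (A₁-cone) × 𝔸ⁿ⁻²` blown up once at its vertex — assembled in
`jordanThree_hasResolution_of_bricks` (p496627) from the bricks `Hregb` (p498967), `HneOb`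
(p498242), `Hdivb` (p497670) (res-D-pv-033 AS stub-5) and the cone brick `HPa` (res-L1-w45c-stub-3).
WORDING OF RECORD (director-resolution 01:13:17Z pattern): a resolution for this family is expected
from Király–Lütkebohmert-type arguments; no claim of novelty in print is made here; AI-written,
kernel-checked, weaker than expert review.
-/

-- single-problem summit: the doubled namespace component `ResolutionOfSingularities` is forced
set_option linter.dupNamespace false

noncomputable section

open CategoryTheory AlgebraicGeometry TopologicalSpace MvPolynomial
open Literature.AlgebraicGeometry.Resolution Literature.AlgebraicGeometry.RelativeSpec

namespace Summit.ResolutionOfSingularities.ResolutionOfSingularities.Theorems.WildQuotientResolution.ToricExit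

/-- **V3U-F `jordanThree_hasResolution`**: the wild quotient singularity `𝔸ⁿ/J₃` (Jordan block of
size three plus passengers, characteristic `p ≥ 3`, any field) has a resolution of singularities.
[OURS · L1 W4.5c] [folklore; assembly of landed decls] -/
theorem jordanThree_hasResolution (p : ℕ) (hp : p.Prime) (hp3 : 3 ≤ p) (k : Type) [Field k]
    [CharP k p] (n : ℕ) (σ : MvPolynomial (Fin n) k ≃ₐ[k] MvPolynomial (Fin n) k) (a b c : Fin n)
    (hab : a ≠ b) (hbc : b ≠ c) (hac : a ≠ c) (hb : σ (X b) = X b + X a)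
    (hc : σ (X c) = X c + X b) (hσ : ∀ i, i ≠ b → i ≠ c → σ (X i) = X i) :
    Scheme.HasResolution
      (Spec (.of (FixedPoints.subalgebra k (MvPolynomial (Fin n) k) (Subgroup.zpowers σ)))) := by
  haveI : Fact (Nat.Prime p) := ⟨hp⟩
  haveI : Finite ↥(Subgroup.zpowers σ) := Nat.finite_of_card_ne_zero (by
    rw [JordanThree.card_zpowers_prime p hp hp3 k n σ a b c hab hac hb hc hσ]; exact hp.ne_zero)
  exact jordanThree_hasResolution_of_bricks p hp hp3 k n σ a b c hab hbc hac hb hc hσ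
    (isRegularLocalRing_stalk_of_mem_blowupChart_centre_b k n a b hab)
    (nonempty_iInf_preimage_blowupChart_centre_b k n σ a b c hab hac hb hσ)
    (fun ρ hρ g v hv hvB => isPrincipal_stalkAug_liftAction_of_mem_blowupChart p hp hp3 k n σ a b c
      hab hac hb hc hσ ρ hρ g v hv hvB)
    (jordanThree_coneBrick p hp hp3 k n σ a b c hab hbc hac hb hc hσ)

end Summit.ResolutionOfSingularities.ResolutionOfSingularities.Theorems.WildQuotientResolution.ToricExit

end
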